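import Summits.NavierStokesRegularity.NavierStokesRegularity.Theses.ExtremiserTransience
import Summits.NavierStokesRegularity.NavierStokesRegularity.Theorems.ExtremiserTransienceSparseSliceTransfer
import Summits.NavierStokesRegularity.NavierStokesRegularity.Theorems.ExtremiserTransiencePerFlowScaleLock
import Summits.NavierStokesRegularity.NavierStokesRegularity.Theorems.ExtremiserTransienceNETPFOfRegularised
import HarnessLib

/-!
# Route `ExtremiserTransience`, item `RegularisedSliceTransfer` (stmt-NavierStokesRegularity-28318) — PROVED

`--workitem stmt-NavierStokesRegularity-28318`.  `RegularisedSliceTransfer_proof : Summit…Theses.ExtremiserTransience.RegularisedSliceTransfer`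
(the route decl BY NAME): `RegularisedNearPlateauStability` (item 28317) implies, for every classical Leray–Hopf rapidly-decaying-datum flow on
`[0,T)` with an eventual Type-I rate, no smooth extension past `T` and failing the per-flow depletion conclusion, the WEAK ONE-SLICE PLATEAU
OBJECT of item 27822 (which the landed `plateauSliceRigidity` excludes; with the closed glue 28319 `NETPFOfRegularised` the parent crux 26567
`NearExtremalTransiencePerFlow` thereby reduces to 28317 alone).

THE PROOF = the item's plan (T1)–(T4), all four steps now in the tree:
* (T1) all-order Type-I rates — `ExtremiserTransience.higherTypeIRates` (seat ns-net-p1 g2, p669723);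
* (T2) at the near-efficient TWO-SIDED-LOCKED late times of the landed `DepletionLadder.PerFlow.scaleLock_at_nearEfficient_times`
  (`c₁ν(T−t)P ≤ Z ≤ c₂ν(T−t)P`, `(κ⋆−ε')`-efficient at a height `M`, `0 < M√Z√P`; non-null for every `ε'` and onset), the slice `u(t)` is
  admissible (budgets `stub_taoCover`), `A`-regular at its own scale `λ = √(Z/P)` with the PER-FLOW budget `A_j = max 1 (C_jΘ'^j/c_L)`
  (`Θ' = max (max c₂ c₁⁻¹) 1`, Leray's lower rate `c_L√ν ≤ √(T−t)M`, `λ ≤ Θ'√(ν(T−t))`), and PINNED: `min(c_L,2C)√ν ≤ √(T−t)M ≤ 2C√ν`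
  (universality of `κ⋆` at the Type-I height, `ε' ≤ κ⋆/2`);
* (T3) 28317 at `(A)` gives `c₀, r` and `ε(δ)`; at such a time a fat near-top ball `vol{x ∈ B(x₀,rλ) : ‖u(t,x)‖ ≥ (1−δ)M} ≥ c₀(rλ)³`, i.e.
  `≥ (c₀/Θ'⁶)(rΘ'√(ν(T−t)))³` inside `B(x₀, rΘ'√(ν(T−t)))`;
* (T4) the plateau zoom — `ExtremiserTransience.plateauZoom` (seat ns-net-p1 g2, p670191).
The bookkeeping lemmas are those of the sparse twin `SparseBangBang.sparseSliceTransfer` (p670994).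
HONEST FRAMING: an implication between statements about hypothetical Type-I singular flows; 28317 is OPEN; nothing about Navier–Stokes
regularity or blow-up is proved; no summit is proved by a line.  Author: prover seat `ns-net-p1` (g2). [folklore]
-/

noncomputable section

open scoped Topology InnerProductSpace RealInnerProductSpace ENNReal ContDiff
open MeasureTheory Filter Set Metric Function
open Literature.Analysis Literature.Analysis.FluidPDE
open Summit.NavierStokesRegularity.NavierStokesRegularity.Theorems.DepletionLadder.KStar
open Summit.NavierStokesRegularity.NavierStokesRegularity.Theorems.DepletionLadder.KStar.HalfSpace
open Summit.NavierStokesRegularity.NavierStokesRegularity.Theorems.NearExtremalTransiencePerFlow.SparseBangBang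
  (lintegral_iteratedFDeriv_slice_lt_top sqrt_div_bounds_of_lock height_le_two_mul_of_efficient)

namespace Summit.NavierStokesRegularity.NavierStokesRegularity.Theorems.ExtremiserTransience

-- the problem directory repeats the summit name (`NavierStokesRegularity/NavierStokesRegularity`)
set_option linter.dupNamespace false

/-- **Item 28318 `RegularisedSliceTransfer`, proved** (the route decl by name): regularised near-plateau stability (28317) transfers, along
every Type-I singular classical Leray–Hopf flow failing the per-flow depletion conclusion, to the weak one-slice plateau object of 27822.
Assembly of the landed T1 (`higherTypeIRates`), the landed scale lock at near-efficient times, Leray's lower rate, universality of `κ⋆`, and the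
landed T4 (`plateauZoom`). [folklore] -/
theorem RegularisedSliceTransfer_proof :
    Summit.NavierStokesRegularity.NavierStokesRegularity.Theses.ExtremiserTransience.RegularisedSliceTransfer := by
  intro hR C ν T hC hν hT u p hsol hLH hdec hrate hext hnot
  have hsν : 0 < Real.sqrt ν := Real.sqrt_pos.2 hν
  have hK : 0 < kStar := kStar_pos
  -- ### per-flow constants
  obtain ⟨cL, hcL, hler⟩ := DepletionLadder.PerFlow.lerayLowerRate_of_not_extends hν hT hsol hLH hdec hext
  obtain ⟨Cs, hCs⟩ := higherTypeIRates C ν T hC hν hT u p hsol hLH hdec hrate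
  obtain ⟨tA, htA, hsubA⟩ := mem_nhdsLT_iff_exists_Ioo_subset.1 hCs
  have htAT : tA < T := htA
  obtain ⟨tB, htB, hsubB⟩ := mem_nhdsLT_iff_exists_Ioo_subset.1 hrate
  have htBT : tB < T := htB
  have hfw := DepletionLadder.flowwise_of_universal DepletionLadder.sharpDepletion_is_universal hν hT hsol hLH hdec
  obtain ⟨c₁, c₂, hc₁, hc₁₂, hlock⟩ :=
    DepletionLadder.PerFlow.scaleLock_at_nearEfficient_times hC hν hT hsol hLH hdec hrate hext hnot
  set Θ : ℝ := max c₂ c₁⁻¹ with hΘdef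
  have hΘpos : 0 < Θ := lt_of_lt_of_le (inv_pos.2 hc₁) (le_max_right _ _)
  have hΘc₂ : c₂ ≤ Θ := le_max_left _ _
  have hΘc₁ : Θ⁻¹ ≤ c₁ := by rw [inv_le_comm₀ hΘpos hc₁]; exact le_max_right _ _
  set Θ' : ℝ := max Θ 1 with hΘ'def
  have hΘ'1 : 1 ≤ Θ' := le_max_right _ _
  have hΘ'pos : 0 < Θ' := lt_of_lt_of_le one_pos hΘ'1
  have hΘΘ' : Θ ≤ Θ' := le_max_left _ _
  set A : ℕ → ℝ := fun j => max 1 (Cs j * Θ' ^ j / cL) with hAdef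
  have hA1 : ∀ j, 1 ≤ A j := fun j => le_max_left _ _
  -- ### 28317 at the per-flow budget `A`
  obtain ⟨c₀, r, hc₀, hr, hRδ⟩ := hR A hA1
  -- ### the data for the plateau zoom
  have key : ∃ c₀' r' cl ch : ℝ, 0 < c₀' ∧ 0 < r' ∧ 0 < cl ∧ cl ≤ ch ∧ ∀ δ : ℝ, 0 < δ → ∀ t₁ ∈ Set.Ico 0 T,
      ∃ t ∈ Set.Ico t₁ T, ∃ (M : ℝ) (x₀ : EuclideanSpace ℝ (Fin 3)), (∀ x, ‖u t x‖ ≤ M) ∧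
        cl * Real.sqrt ν ≤ Real.sqrt (T - t) * M ∧ Real.sqrt (T - t) * M ≤ ch * Real.sqrt ν ∧
        ENNReal.ofReal (c₀' * (r' * Real.sqrt (ν * (T - t))) ^ 3) ≤
          MeasureTheory.volume {x : EuclideanSpace ℝ (Fin 3) | x ∈ Metric.ball x₀ (r' * Real.sqrt (ν * (T - t))) ∧
            (1 - δ) * M ≤ ‖u t x‖} := by
    refine ⟨c₀ / Θ' ^ 6, r * Θ', min cL (2 * C), 2 * C, by positivity, by positivity, lt_min hcL (by positivity),
      min_le_right _ _, fun δ hδ t₁ ht₁ => ?_⟩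
    obtain ⟨ε, hε, hRv⟩ := hRδ δ hδ
    set ε' : ℝ := min ε (kStar / 2) with hε'def
    have hε' : 0 < ε' := lt_min hε (half_pos hK)
    have hε'ε : ε' ≤ ε := min_le_left _ _
    have hε'K : ε' ≤ kStar / 2 := min_le_right _ _
    -- the onset: past `t₁`, `T/2`, and the onsets of (T1) and of the Type-I rate
    set t₂ : ℝ := max (max t₁ (T / 2)) (max ((tA + T) / 2) ((tB + T) / 2)) with ht₂def
    have ht₂T : t₂ < T :=
      max_lt (max_lt ht₁.2 (by linarith)) (max_lt (by linarith) (by linarith))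
    have ht₂0 : 0 ≤ t₂ := le_trans (by linarith : (0 : ℝ) ≤ T / 2) ((le_max_right _ _).trans (le_max_left _ _))
    -- a near-efficient two-sided-locked time past the onset
    have hne := hlock ε' hε' t₂ ⟨ht₂0, ht₂T⟩
    obtain ⟨t, ht⟩ := nonempty_of_measure_ne_zero hne
    simp only [Set.mem_setOf_eq] at ht
    obtain ⟨ht, hlockl, hlocku, hcd, hdiv, ⟨B, hB⟩, hb1, hb2, M, hM, hpos, heff⟩ := ht
    -- where `t` sits
    have htT : t < T := ht.2
    have hTt : 0 < T - t := sub_pos.2 htT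
    have ht₁t : t₁ ≤ t := le_trans ((le_max_left _ _).trans (le_max_left _ _)) ht.1
    have htI : t ∈ Set.Ico 0 T := ⟨ht₁.1.trans ht₁t, htT⟩
    have htAt : tA < t := lt_of_lt_of_le (by linarith) (((le_max_left _ _).trans (le_max_right _ _)).trans ht.1)
    have htBt : tB < t := lt_of_lt_of_le (by linarith) (((le_max_right _ _).trans (le_max_right _ _)).trans ht.1)
    have hsT : 0 < Real.sqrt (T - t) := Real.sqrt_pos.2 hTt
    -- abbreviations
    set Z : ℝ := ∫ x, ‖curl (u t) x‖ ^ 2 with hZdef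
    set P : ℝ := ∫ x, frobeniusNormSq (fderiv ℝ (curl (u t)) x) with hPdef
    set J : ℝ := ∫ x, ⟪curl (u t) x, fderiv ℝ (u t) x (curl (u t) x)⟫_ℝ with hJdef
    set X : ℝ := ν * (T - t) with hXdef
    have hX : 0 < X := mul_pos hν hTt
    have hsXpos : 0 < Real.sqrt X := Real.sqrt_pos.2 hX
    -- efficiency in terms of `κ⋆`
    have heffK : (kStar - ε') * M * Real.sqrt Z * Real.sqrt P ≤ |J| := by
      unfold kStar udcSet; exact heff
    -- positivity of `M`, `Z`, `P`
    have hMnn : 0 ≤ M := (norm_nonneg _).trans (hM 0)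
    have hM0 : 0 < M := by
      rcases hMnn.eq_or_lt with h | h
      · rw [← h, zero_mul, zero_mul] at hpos; exact absurd hpos (lt_irrefl _)
      · exact h
    have hsZ : 0 < Real.sqrt Z := by
      rcases (Real.sqrt_nonneg Z).eq_or_lt with h | h
      · rw [← h, mul_zero, zero_mul] at hpos; exact absurd hpos (lt_irrefl _)
      · exact h
    have hsP : 0 < Real.sqrt P := by
      rcases (Real.sqrt_nonneg P).eq_or_lt with h | h
      · rw [← h, mul_zero] at hpos; exact absurd hpos (lt_irrefl _)
      · exact h
    have hZ : 0 < Z := Real.sqrt_pos.1 hsZ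
    have hP : 0 < P := Real.sqrt_pos.1 hsP
    -- the lock in the `Θ` form and the Taylor length `L = √(Z/P)` in parabolic units
    have hlo : Θ⁻¹ * X * P ≤ Z :=
      le_trans (mul_le_mul_of_nonneg_right (mul_le_mul_of_nonneg_right hΘc₁ hX.le) hP.le) hlockl
    have hup : Z ≤ Θ * X * P :=
      hlocku.trans (mul_le_mul_of_nonneg_right (mul_le_mul_of_nonneg_right hΘc₂ hX.le) hP.le)
    set L : ℝ := Real.sqrt (Z / P) with hLdef
    obtain ⟨hLU, hLL⟩ := sqrt_div_bounds_of_lock hP hX hΘpos hΘΘ' hΘ'1 hlo hup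
    have hL : 0 < L := lt_of_lt_of_le (div_pos hsXpos hΘ'pos) hLL
    -- Leray at `t`: `cL √ν ≤ √(T−t) M`, hence `√ν/√(T−t) ≤ M/cL`
    have hpinl : cL * Real.sqrt ν ≤ Real.sqrt (T - t) * M := by
      obtain ⟨xL, hxL⟩ := hler t htI
      exact hxL.trans (mul_le_mul_of_nonneg_left (hM xL) (Real.sqrt_nonneg _))
    have hsle : Real.sqrt ν / Real.sqrt (T - t) ≤ M / cL := by
      rw [div_le_div_iff₀ hsT hcL]
      calc Real.sqrt ν * cL = cL * Real.sqrt ν := mul_comm _ _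
        _ ≤ Real.sqrt (T - t) * M := hpinl
        _ = M * Real.sqrt (T - t) := mul_comm _ _
    -- the Type-I height at `t` and the upper pinning `√(T−t) M ≤ 2C√ν`
    set Mt : ℝ := C * Real.sqrt ν / Real.sqrt (T - t) with hMtdef
    have hMt : ∀ x, ‖u t x‖ ≤ Mt := fun x => by
      have h := hsubB ⟨htBt, htT⟩ x
      rw [hMtdef, le_div_iff₀ hsT, mul_comm]; exact h
    have hJ : |J| ≤ kStar * Mt * Real.sqrt Z * Real.sqrt P := by
      have h := hfw t htI Mt hMt
      unfold kStar udcSet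
      exact h
    have hpinu : Real.sqrt (T - t) * M ≤ 2 * C * Real.sqrt ν := by
      have h5 : M ≤ 2 * Mt := height_le_two_mul_of_efficient hK hε'K hM0.le hsZ hsP heffK hJ
      calc Real.sqrt (T - t) * M ≤ Real.sqrt (T - t) * (2 * Mt) := mul_le_mul_of_nonneg_left h5 hsT.le
        _ = 2 * C * Real.sqrt ν := by rw [hMtdef]; field_simp
    -- (T1) at `t`: `‖Dʲu(t)‖ ≤ Cs j · s · qʲ` with `s = √ν/√(T−t) ≤ M/cL`, `q = (√X)⁻¹ ≤ Θ' L⁻¹`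
    have hD : ∀ (j : ℕ) (x : EuclideanSpace ℝ (Fin 3)), ‖iteratedFDeriv ℝ j (u t) x‖ ≤
        Cs j * (Real.sqrt ν / Real.sqrt (T - t)) * (Real.sqrt (ν * (T - t)))⁻¹ ^ j := hsubA ⟨htAt, htT⟩
    have hs0 : 0 < Real.sqrt ν / Real.sqrt (T - t) := div_pos hsν hsT
    have hq0 : 0 < (Real.sqrt (ν * (T - t)))⁻¹ := inv_pos.2 hsXpos
    have hqle : (Real.sqrt (ν * (T - t)))⁻¹ ≤ Θ' * L⁻¹ := by
      rw [← div_eq_mul_inv, le_div_iff₀ hL, inv_mul_le_iff₀ hsXpos, mul_comm]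
      exact hLU
    have hCs0 : ∀ j, 0 ≤ Cs j := fun j => by
      by_contra h
      push Not at h
      have h1 := hD j 0
      have h2 : Cs j * (Real.sqrt ν / Real.sqrt (T - t)) * (Real.sqrt (ν * (T - t)))⁻¹ ^ j < 0 :=
        mul_neg_of_neg_of_pos (mul_neg_of_neg_of_pos h hs0) (pow_pos hq0 j)
      linarith [norm_nonneg (iteratedFDeriv ℝ j (u t) 0)]
    have hReg : ∀ (j : ℕ) (x : EuclideanSpace ℝ (Fin 3)), ‖iteratedFDeriv ℝ j (u t) x‖ ≤ A j * M * (Real.sqrt (Z / P))⁻¹ ^ j := by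
      intro j x
      calc ‖iteratedFDeriv ℝ j (u t) x‖ ≤ Cs j * (Real.sqrt ν / Real.sqrt (T - t)) * (Real.sqrt (ν * (T - t)))⁻¹ ^ j :=
            hD j x
        _ ≤ Cs j * (M / cL) * (Θ' * L⁻¹) ^ j :=
            mul_le_mul (mul_le_mul_of_nonneg_left hsle (hCs0 j)) (pow_le_pow_left₀ hq0.le hqle j)
              (pow_nonneg hq0.le j) (mul_nonneg (hCs0 j) (div_nonneg hM0.le hcL.le))
        _ = Cs j * Θ' ^ j / cL * M * L⁻¹ ^ j := by rw [mul_pow]; ring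
        _ ≤ A j * M * L⁻¹ ^ j :=
            mul_le_mul_of_nonneg_right (mul_le_mul_of_nonneg_right (le_max_right _ _) hM0.le)
              (pow_nonneg (inv_nonneg.2 hL.le) j)
    -- finite energy of the slice
    have hb0 : ∫⁻ x, ‖iteratedFDeriv ℝ 0 (u t) x‖ₑ ^ 2 < ⊤ := lintegral_iteratedFDeriv_slice_lt_top hν hT hsol hLH hdec htI 0
    -- efficiency at level `ε` (`ε' ≤ ε`), in the unfolded form 28317 consumes
    have heffε : (kStar - ε) * M * Real.sqrt Z * Real.sqrt P ≤ |J| := by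
      refine le_trans ?_ heffK
      have : (kStar - ε) * M ≤ (kStar - ε') * M := mul_le_mul_of_nonneg_right (by linarith) hM0.le
      exact mul_le_mul_of_nonneg_right (mul_le_mul_of_nonneg_right this (Real.sqrt_nonneg _)) (Real.sqrt_nonneg _)
    have heffε' := heffε
    unfold kStar udcSet at heffε'
    -- ### 28317: a fat near-top ball of radius `rL`
    obtain ⟨x₀, hfat⟩ := hRv (u t) M B hcd hdiv hM hB hb0 hb1 hb2 hReg hpos heffε'
    refine ⟨t, ⟨ht₁t, htT⟩, M, x₀, hM, ?_, hpinu, ?_⟩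
    · exact le_trans (mul_le_mul_of_nonneg_right (min_le_left _ _) hsν.le) hpinl
    · -- parabolic units: `B(x₀, rL) ⊆ B(x₀, rΘ'√X)` and `c₀(rL)³ ≥ (c₀/Θ'⁶)(rΘ'√X)³`
      have hrad : r * L ≤ r * Θ' * Real.sqrt (ν * (T - t)) := by
        rw [mul_assoc]; exact mul_le_mul_of_nonneg_left hLU hr.le
      have hvol : c₀ / Θ' ^ 6 * (r * Θ' * Real.sqrt (ν * (T - t))) ^ 3 ≤ c₀ * (r * L) ^ 3 := by
        have e : c₀ / Θ' ^ 6 * (r * Θ' * Real.sqrt (ν * (T - t))) ^ 3 = c₀ * (r * (Real.sqrt X / Θ')) ^ 3 := by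
          rw [hXdef]; field_simp
        rw [e]
        gcongr
      calc ENNReal.ofReal (c₀ / Θ' ^ 6 * (r * Θ' * Real.sqrt (ν * (T - t))) ^ 3)
          ≤ ENNReal.ofReal (c₀ * (r * L) ^ 3) := ENNReal.ofReal_le_ofReal hvol
        _ ≤ volume {x : EuclideanSpace ℝ (Fin 3) | x ∈ Metric.ball x₀ (r * L) ∧ (1 - δ) * M ≤ ‖u t x‖} := hfat
        _ ≤ volume {x : EuclideanSpace ℝ (Fin 3) | x ∈ Metric.ball x₀ (r * Θ' * Real.sqrt (ν * (T - t))) ∧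
              (1 - δ) * M ≤ ‖u t x‖} :=
            measure_mono fun x hx => ⟨Metric.ball_subset_ball hrad hx.1, hx.2⟩
  -- ### (T4) the plateau zoom
  exact plateauZoom C ν T hC hν hT u p hsol hLH hdec hrate key

/-! ## Corollaries (appended): item 27822 `PlateauSliceTransfer` by name, and the crux 26567 from 28317 / from 27676 alone

`--workitem stmt-NavierStokesRegularity-27822`.  `LocalNearPlateauStability` (27676) is the budget-free strengthening of
`RegularisedNearPlateauStability` (landed `regularised_of_lnps`), so the regularised transfer above proves item 27822 verbatim; and with the
closed glue 28319 (`netpf_of_regularised`) the rank-2 crux 26567 `NearExtremalTransiencePerFlow` now rests on item 28317 ALONE (or on 27676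
alone), by name.  HONEST FRAMING: 27676 and 28317 are OPEN; no summit is proved by a line. -/

/-- **Item 27822 `PlateauSliceTransfer`, proved** (the route decl by name): local near-plateau stability (27676) transfers along every Type-I
singular classical Leray–Hopf flow failing the per-flow depletion conclusion to the weak one-slice plateau object — via `regularised_of_lnps` and
`RegularisedSliceTransfer_proof`. [folklore] -/
theorem PlateauSliceTransfer_proof :
    Summit.NavierStokesRegularity.NavierStokesRegularity.Theses.ExtremiserTransience.PlateauSliceTransfer :=
  fun hL => RegularisedSliceTransfer_proof
    (Summit.NavierStokesRegularity.NavierStokesRegularity.Theses.ExtremiserTransience.regularised_of_lnps hL)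

/-- **The crux 26567 from item 28317 alone, by name**: `RegularisedNearPlateauStability → NearExtremalTransiencePerFlow`
(glue `netpf_of_regularised` + `RegularisedSliceTransfer_proof`). [folklore] -/
theorem nearExtremalTransiencePerFlow_of_regularisedNearPlateauStability
    (h : Summit.NavierStokesRegularity.NavierStokesRegularity.Theses.ExtremiserTransience.RegularisedNearPlateauStability) :
    Summit.NavierStokesRegularity.NavierStokesRegularity.Theses.ExtremiserTransience.NearExtremalTransiencePerFlow :=
  Summit.NavierStokesRegularity.NavierStokesRegularity.Theses.ExtremiserTransience.netpf_of_regularised h RegularisedSliceTransfer_proof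

/-- **The crux 26567 from item 27676 alone, by name**: `LocalNearPlateauStability → NearExtremalTransiencePerFlow`. [folklore] -/
theorem nearExtremalTransiencePerFlow_of_localNearPlateauStability
    (h : Summit.NavierStokesRegularity.NavierStokesRegularity.Theses.ExtremiserTransience.LocalNearPlateauStability) :
    Summit.NavierStokesRegularity.NavierStokesRegularity.Theses.ExtremiserTransience.NearExtremalTransiencePerFlow :=
  nearExtremalTransiencePerFlow_of_regularisedNearPlateauStability
    (Summit.NavierStokesRegularity.NavierStokesRegularity.Theses.ExtremiserTransience.regularised_of_lnps h)

end Summit.NavierStokesRegularity.NavierStokesRegularity.Theorems.ExtremiserTransience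

end
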